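import Literature.AlgebraicGeometry.Motives.SeesawRelativeChartKernelReprTheta
import Literature.AlgebraicGeometry.Motives.SeesawRelativeChartDualKernelRepr
import Literature.AlgebraicGeometry.Modules.RelativeGrothendieckComplexKernelReprNatural
import Literature.AlgebraicGeometry.Motives.SeesawChartKernelRepr
import HarnessLib

/-!
# RELATIVE EDITION (ring base `R`) — `H0KernelRepr X 𝓕 U` DISCHARGED over a ring base: the Grothendieck complex of the seesaw chart
# computes `H⁰(X_B, 𝓕_B)` after every base change, naturally (Mumford AV §5, Lemmas 1–2, Cor. 2; GW II Cor. 23.135 / (23.28.5))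

RELATIVE EDITION of ★ `Motives/SeesawChartKernelRepr` (cell `hodgecm-mathlib`, F-DAG hand (h8-E) «engine of the relative seesaw»,
file E11 — THE ENGINE HEAD; author B-p08 (g12); port map `B-provers/B-p08/g11/PORTMAP-h8-RelativeSeesaw.B-p08g11.md`, un-parked by
B-plan1 (g15) 2026-08-30T04:48:23Z).  **`SeesawRelative.h0KernelRepr_holds : H0KernelRepr X 𝓕 U`** and **`dualKernelRepr_holds :
DualKernelRepr X 𝓕 U h𝓕`** (g11՚s ★ relative sockets of `Motives/SeesawRelativeChartRepr`, VERBATIM) for every rank-one `𝓕` on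
`X ×_R W`, `X → Spec R` proper, geometrically integral, FLAT and UNIVERSALLY OPEN (the two binders that replace ★՚s field lemmas
`flat_hom_of_field` / `universallyOpen_hom_of_isProper`; Mathlib՚s instance `UniversallyOpen.of_flat` discharges the second for flat
l.f.p. `X`, e.g. abelian schemes), `W` locally noetherian (replacing ★՚s `LocallyOfFiniteType W.hom` over `ℂ`), `U ⊆ W` affine open —
so that the (h2)/(h8) engine seam `hX` of g11՚s ★ R10 head `SeesawRelative.exists_seesawSubscheme_of_repr` is discharged by
`h0Repr_of_kernelRepr` / `dualRepr_of_kernelRepr` (file E12).  Decl for decl the twin of ★ with `ℂ ↦ R`: `h0KernelRepr_of_naturality`,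
`thetaLin_natural` (the `maxHeartbeats 800000` line CARRIED from ★, same proof), `h0KernelRepr_holds`, `dualKernelRepr_holds`; inputs
E9 `thetaLin` / `secModOfIso_H0map`, E7 `Modules.Relative.kernelReprEquiv_natural`, E10 `dualKernelRepr_of_h0KernelRepr_dual`, ★ base-free
`RingIsoBaseChange.tau*`, ★ `Modules.hasRank_dual`.  Everything is proved; no named facts, no `sorry`.  HC_CM is proved only modulo the 7
printed citations until rung 0 closes; this file asserts nothing about HC.  Original module docstring (read `ℂ` as `R`):

**`h0KernelRepr_holds : H0KernelRepr X 𝓕 U`** (★ `Motives.SeesawChartRepr`, B-p01's statement, verbatim) for every rank-one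
`𝓕` on `X × W` with `X` proper and geometrically integral over `ℂ`, `W` locally of finite type, `U ⊆ W` an affine open:
the two-term complex `dKX : K⁰ → K¹` of finitely generated projective `A = Γ(W, U)`-modules of
★ `Motives.SeesawChartKernelReprTheta` represents `B ↦ H⁰(X_B, 𝓕_B)` naturally in the `A`-algebra `B`, the isomorphism being
the adapter `thetaLin`.  The one new content here is the NATURALITY of `θ` along `A`-algebra maps `φ : B → C`
(`thetaLin_natural`: `θ_C ∘ H⁰(φ) = (φ ⊗ 1) ∘ θ_B`), assembled from step (i) `secModOfIso_H0map`, ★ `Modules.kernelReprEquiv_natural`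
(step (ii)) and ★ `RingIsoBaseChange.tau_symm_rTensor` (step (iii)) by an explicit chain of `congrArg`/`Eq.trans` with syntactic
junctions; `h0KernelRepr_of_naturality` packages the data into the socket and `h0KernelRepr_holds` picks a finite affine Čech cover
(`exists_affine_cechCover`); the dual twin `dualKernelRepr_holds` follows at `𝓕^∨` through ★ `dualKernelRepr_of_h0KernelRepr_dual`.

## References
* [MumfordAV1970] D. Mumford, *Abelian Varieties*, TIFR Studies in Mathematics 5 (1970), §5, Lemmas 1–2, Cor. 2 (pp. 46–50).
* [GortzWedhorn2023] U. Görtz, T. Wedhorn, *Algebraic Geometry II: Cohomology of Schemes* (2023), Cor. 23.135 (p. 355), (23.28.5).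
-/

set_option autoImplicit false

noncomputable section

set_option backward.isDefEq.respectTransparency false

open CategoryTheory CategoryTheory.Limits AlgebraicGeometry MonoidalCategory CartesianMonoidalCategory
  Opposite TopologicalSpace
open scoped TensorProduct

namespace Literature.AlgebraicGeometry.Motives

namespace SeesawRelative

open Literature.AlgebraicGeometry.Modules Literature.Algebra.Module.RingIsoBaseChange

section Assembly

variable {R : Type} [CommRing R] (X : SchemeOver R) {W : SchemeOver R} (𝓕 : (X ⊗ W).left.Modules) (U : W.left.affineOpens)
  [IsProper X.hom] [GeometricallyIntegral X.hom] [Flat X.hom] [UniversallyOpen X.hom] [IsLocallyNoetherian W.left]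
  (h𝓕 : HasRank 𝓕 1)
  {n : ℕ} (𝓥 : Fin n → (X ⊗ SeesawRelative.specTest U Γ(W.left, U)).left.Opens)
  (hV : ∀ s : Finset (Fin n), s.Nonempty → IsAffineOpen (cechOpen 𝓥 s)) (hcov : ⨆ i, 𝓥 i = ⊤)

/-- **`H0KernelRepr` from the naturality of `θ`**: the data `K⁰ = K•⁰`, `K¹ = K•¹` (B-p10's Grothendieck complex of
`𝓕_A` on a finite affine cover of `X × Spec A`, scalars restricted to `A` along `ΓSpecIso`), `d = d⁰¹`,
`θ_B = SeesawRelative.thetaLin`, packaged into B-p01's literal socket, GIVEN the naturality square of `θ` along `A`-algebra maps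
(= B-p10 (g8)'s §4 `kernelReprEquiv` naturality + the `FBIso`/`pullSec` coherence + `tau_rTensor`).
[cite: MumfordAV1970, §5 (pp. 46–47)] [cite: GortzWedhorn2023, Cor. 23.135 (p. 355)] -/
theorem h0KernelRepr_of_naturality
    (hnat : ∀ (B C : Type) [CommRing B] [Algebra Γ(W.left, U) B] [CommRing C] [Algebra Γ(W.left, U) C]
      (φ : B →ₐ[Γ(W.left, U)] C) (s : SeesawRelative.H0 X 𝓕 U B),
      ((SeesawRelative.thetaLin X 𝓕 U h𝓕 𝓥 hV hcov C (SeesawRelative.H0map X 𝓕 U φ s) :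
          LinearMap.ker ((SeesawRelative.dKX X 𝓕 U h𝓕 𝓥 hV hcov).baseChange C)) : C ⊗[Γ(W.left, U)] (SeesawRelative.KX X 𝓕 U h𝓕 𝓥 hV hcov).X 0) =
        φ.toLinearMap.rTensor ((SeesawRelative.KX X 𝓕 U h𝓕 𝓥 hV hcov).X 0)
          ((SeesawRelative.thetaLin X 𝓕 U h𝓕 𝓥 hV hcov B s : LinearMap.ker ((SeesawRelative.dKX X 𝓕 U h𝓕 𝓥 hV hcov).baseChange B)) :
            B ⊗[Γ(W.left, U)] (SeesawRelative.KX X 𝓕 U h𝓕 𝓥 hV hcov).X 0)) :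
    SeesawRelative.H0KernelRepr X 𝓕 U :=
  ⟨(SeesawRelative.KX X 𝓕 U h𝓕 𝓥 hV hcov).X 0, (SeesawRelative.KX X 𝓕 U h𝓕 𝓥 hV hcov).X 1, inferInstance, inferInstance, inferInstance,
    inferInstance, SeesawRelative.finite_KX X 𝓕 U h𝓕 𝓥 hV hcov 0, SeesawRelative.projective_KX X 𝓕 U h𝓕 𝓥 hV hcov 0,
    SeesawRelative.finite_KX X 𝓕 U h𝓕 𝓥 hV hcov 1, SeesawRelative.projective_KX X 𝓕 U h𝓕 𝓥 hV hcov 1, SeesawRelative.dKX X 𝓕 U h𝓕 𝓥 hV hcov,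
    fun B _ _ => SeesawRelative.thetaLin X 𝓕 U h𝓕 𝓥 hV hcov B, fun B C _ _ _ _ φ s => hnat B C φ s⟩

set_option maxHeartbeats 800000 in
/-- **NATURALITY OF THE ADAPTER `θ`** along `A`-algebra maps `φ : B → C`: `θ_C ∘ H⁰(φ) = (φ ⊗ 1) ∘ θ_B`. Assembled
from step (i) `secModOfIso_H0map` (PART C coherence), B-p10 (g8)'s §5 `kernelReprEquiv_natural` (step (ii)) and
PART A `tau_symm_rTensor` (step (iii)), by an explicit chain of `congrArg`/`Eq.trans` whose junctions are syntactic.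
[cite: MumfordAV1970, §5 (pp. 46–47)] [cite: GortzWedhorn2023, Cor. 23.135 (p. 355) and (23.28.5)] -/
theorem thetaLin_natural (B C : Type) [CommRing B] [Algebra Γ(W.left, U) B] [CommRing C] [Algebra Γ(W.left, U) C]
    (φ : B →ₐ[Γ(W.left, U)] C) (s : SeesawRelative.H0 X 𝓕 U B) :
    ((SeesawRelative.thetaLin X 𝓕 U h𝓕 𝓥 hV hcov C (SeesawRelative.H0map X 𝓕 U φ s) :
        LinearMap.ker ((SeesawRelative.dKX X 𝓕 U h𝓕 𝓥 hV hcov).baseChange C)) : C ⊗[Γ(W.left, U)] (SeesawRelative.KX X 𝓕 U h𝓕 𝓥 hV hcov).X 0) =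
      φ.toLinearMap.rTensor ((SeesawRelative.KX X 𝓕 U h𝓕 𝓥 hV hcov).X 0)
        ((SeesawRelative.thetaLin X 𝓕 U h𝓕 𝓥 hV hcov B s : LinearMap.ker ((SeesawRelative.dKX X 𝓕 U h𝓕 𝓥 hV hcov).baseChange B)) :
          B ⊗[Γ(W.left, U)] (SeesawRelative.KX X 𝓕 U h𝓕 𝓥 hV hcov).X 0) := by
  haveI := SeesawRelative.isNoetherianRing_ΓSpec_chart U
  haveI := SeesawRelative.isLocallyNoetherian_specTest_chart U
  letI := Modules.Relative.testAlgebra (SeesawRelative.specTest U Γ(W.left, U)) (SeesawRelative.jTest U B)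
  letI := Modules.Relative.testAlgebra (SeesawRelative.specTest U Γ(W.left, U)) (SeesawRelative.jTest U C)
  -- (a) `θ` unfolded at `C` and at `B`
  have aC := congrArg (fun z : LinearMap.ker ((SeesawRelative.dKX X 𝓕 U h𝓕 𝓥 hV hcov).baseChange C) =>
      (z : C ⊗[Γ(W.left, U)] (SeesawRelative.KX X 𝓕 U h𝓕 𝓥 hV hcov).X 0))
    ((congrFun (SeesawRelative.coe_thetaLin X 𝓕 U h𝓕 𝓥 hV hcov C) (SeesawRelative.H0map X 𝓕 U φ s)).trans
      (congrFun (SeesawRelative.coe_thetaAdd X 𝓕 U h𝓕 𝓥 hV hcov C) (SeesawRelative.H0map X 𝓕 U φ s)))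
  have aB := congrArg (fun z : LinearMap.ker ((SeesawRelative.dKX X 𝓕 U h𝓕 𝓥 hV hcov).baseChange B) =>
      (z : B ⊗[Γ(W.left, U)] (SeesawRelative.KX X 𝓕 U h𝓕 𝓥 hV hcov).X 0))
    ((congrFun (SeesawRelative.coe_thetaLin X 𝓕 U h𝓕 𝓥 hV hcov B) s).trans (congrFun (SeesawRelative.coe_thetaAdd X 𝓕 U h𝓕 𝓥 hV hcov B) s))
  -- (b) `kerTau⁻¹` on underlying tensors
  have bC := coe_kerTau_symm (eA := SeesawRelative.εR U Γ(W.left, U)) (eB := SeesawRelative.εR U C) (heB := SeesawRelative.εR_algebraMap U C)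
    (SeesawRelative.smul_KX X 𝓕 U h𝓕 𝓥 hV hcov 0) (SeesawRelative.smul_KX X 𝓕 U h𝓕 𝓥 hV hcov 1) ((SeesawRelative.KX X 𝓕 U h𝓕 𝓥 hV hcov).d 0 1).hom
    (Relative.kernelReprEquiv X (SeesawRelative.specTest U Γ(W.left, U)) 𝓥 (SeesawRelative.FB X 𝓕 U Γ(W.left, U)) hV hcov
      (SeesawRelative.hasRank_FB X 𝓕 U h𝓕 Γ(W.left, U)) (SeesawRelative.jTest U C)
      (SeesawSubscheme.secModOfIso (Relative.baseToTotal X (SeesawRelative.specTest U C)) (SeesawRelative.FBIso X 𝓕 U (Algebra.ofId Γ(W.left, U) C)) (SeesawRelative.H0map X 𝓕 U φ s)))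
  have bB := coe_kerTau_symm (eA := SeesawRelative.εR U Γ(W.left, U)) (eB := SeesawRelative.εR U B) (heB := SeesawRelative.εR_algebraMap U B)
    (SeesawRelative.smul_KX X 𝓕 U h𝓕 𝓥 hV hcov 0) (SeesawRelative.smul_KX X 𝓕 U h𝓕 𝓥 hV hcov 1) ((SeesawRelative.KX X 𝓕 U h𝓕 𝓥 hV hcov).d 0 1).hom
    (Relative.kernelReprEquiv X (SeesawRelative.specTest U Γ(W.left, U)) 𝓥 (SeesawRelative.FB X 𝓕 U Γ(W.left, U)) hV hcov
      (SeesawRelative.hasRank_FB X 𝓕 U h𝓕 Γ(W.left, U)) (SeesawRelative.jTest U B)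
      (SeesawSubscheme.secModOfIso (Relative.baseToTotal X (SeesawRelative.specTest U B)) (SeesawRelative.FBIso X 𝓕 U (Algebra.ofId Γ(W.left, U) B)) s))
  -- (c) step (i) transported
  have cC := congrArg (fun w => (tau (SeesawRelative.εR U Γ(W.left, U)) (SeesawRelative.εR U C) (SeesawRelative.εR_algebraMap U C)
      (SeesawRelative.smul_KX X 𝓕 U h𝓕 𝓥 hV hcov 0)).symm
      ((Relative.kernelReprEquiv X (SeesawRelative.specTest U Γ(W.left, U)) 𝓥 (SeesawRelative.FB X 𝓕 U Γ(W.left, U)) hV hcov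
        (SeesawRelative.hasRank_FB X 𝓕 U h𝓕 Γ(W.left, U)) (SeesawRelative.jTest U C) w : LinearMap.ker _) :
          Γ((SeesawRelative.specTest U C).left, (⊤ : (SeesawRelative.specTest U C).left.Opens)) ⊗[Γ((SeesawRelative.specTest U Γ(W.left, U)).left,
            (⊤ : (SeesawRelative.specTest U Γ(W.left, U)).left.Opens))] _))
    (SeesawRelative.secModOfIso_H0map X 𝓕 U φ s)
  -- (d) B-p10 (g8)'s naturality of the kernel representation, transported by `τ_C⁻¹`
  have dd := congrArg (fun v => (tau (SeesawRelative.εR U Γ(W.left, U)) (SeesawRelative.εR U C) (SeesawRelative.εR_algebraMap U C)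
      (SeesawRelative.smul_KX X 𝓕 U h𝓕 𝓥 hV hcov 0)).symm v)
    (Relative.kernelReprEquiv_natural X (SeesawRelative.specTest U Γ(W.left, U)) 𝓥 (SeesawRelative.FB X 𝓕 U Γ(W.left, U)) hV hcov
      (SeesawRelative.hasRank_FB X 𝓕 U h𝓕 Γ(W.left, U)) (SeesawRelative.jTest U B) (SeesawRelative.jTest U C) (SeesawRelative.specTestMap U φ) (SeesawRelative.specTestMap_comp_jTest U φ)
      (SeesawSubscheme.secModOfIso (Relative.baseToTotal X (SeesawRelative.specTest U B)) (SeesawRelative.FBIso X 𝓕 U (Algebra.ofId Γ(W.left, U) B)) s))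
  -- (e) `τ⁻¹` along `φ`
  have ee := tau_symm_rTensor (SeesawRelative.εR U Γ(W.left, U)) (SeesawRelative.εR U B) (SeesawRelative.εR_algebraMap U B) (SeesawRelative.smul_KX X 𝓕 U h𝓕 𝓥 hV hcov 0)
    (SeesawRelative.εR U C) (SeesawRelative.εR_algebraMap U C) φ
    (Relative.testAlgHom (SeesawRelative.specTest U Γ(W.left, U)) (SeesawRelative.jTest U B) (SeesawRelative.jTest U C) (SeesawRelative.specTestMap U φ) (SeesawRelative.specTestMap_comp_jTest U φ))
    (fun b => (SeesawRelative.εR_natural U φ b).trans (Relative.testAlgHom_apply (SeesawRelative.specTest U Γ(W.left, U)) (SeesawRelative.jTest U B) (SeesawRelative.jTest U C)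
      (SeesawRelative.specTestMap U φ) (SeesawRelative.specTestMap_comp_jTest U φ) (SeesawRelative.εR U B b)).symm)
    ((Relative.kernelReprEquiv X (SeesawRelative.specTest U Γ(W.left, U)) 𝓥 (SeesawRelative.FB X 𝓕 U Γ(W.left, U)) hV hcov
        (SeesawRelative.hasRank_FB X 𝓕 U h𝓕 Γ(W.left, U)) (SeesawRelative.jTest U B)
        (SeesawSubscheme.secModOfIso (Relative.baseToTotal X (SeesawRelative.specTest U B)) (SeesawRelative.FBIso X 𝓕 U (Algebra.ofId Γ(W.left, U) B)) s) :
          LinearMap.ker _) :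
      Γ((SeesawRelative.specTest U B).left, (⊤ : (SeesawRelative.specTest U B).left.Opens)) ⊗[Γ((SeesawRelative.specTest U Γ(W.left, U)).left,
        (⊤ : (SeesawRelative.specTest U Γ(W.left, U)).left.Opens))] _)
  exact aC.trans (bC.trans (cC.trans (dd.trans (ee.trans
    (congrArg (fun u => φ.toLinearMap.rTensor ((SeesawRelative.KX X 𝓕 U h𝓕 𝓥 hV hcov).X 0) u) (aB.trans bB).symm)))))

include h𝓕 in
/-- **SOCKET (1b) `H0KernelRepr X 𝓕 U` DISCHARGED** for every rank-one `𝓕` on `X × W` (`X` proper, geometrically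
integral; `W` locally of finite type over `ℂ`; `U ⊆ W` affine open): the two-term complex `d : K⁰ → K¹` of finitely
generated projective `A = Γ(W, U)`-modules (B-p10 (g8)'s Grothendieck complex of `𝓕_A` over a finite affine cover of
`X × Spec A`, scalars restricted along `A ≅ Γ(Spec A, 𝒪)`) represents `B ↦ H⁰(X_B, 𝓕_B)` naturally in the
`A`-algebra `B`. [cite: MumfordAV1970, §5 (pp. 46–47)] [cite: GortzWedhorn2023, Cor. 23.135 (p. 355) and (23.28.5)] -/
theorem h0KernelRepr_holds : SeesawRelative.H0KernelRepr X 𝓕 U := by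
  haveI := SeesawRelative.isNoetherianRing_ΓSpec_chart U
  haveI := SeesawRelative.isLocallyNoetherian_specTest_chart U
  obtain ⟨n, 𝓥, hV, hcov⟩ := SeesawRelative.exists_affine_cechCover X (SeesawRelative.specTest U Γ(W.left, U))
  exact SeesawRelative.h0KernelRepr_of_naturality X 𝓕 U h𝓕 𝓥 hV hcov
    (fun B C _ _ _ _ φ s => SeesawRelative.thetaLin_natural X 𝓕 U h𝓕 𝓥 hV hcov B C φ s)

/-- **SOCKET (1b) `DualKernelRepr X 𝓕 U h𝓕` DISCHARGED** — the same statement for the dual sections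
`Hom(𝓕_B|_⊤, 𝒪|_⊤)` (★ `Motives.SeesawChartRepr`), from `h0KernelRepr_holds` at the rank-one dual `𝓕^∨`
(★ `Modules.hasRank_dual`) through ★ `dualKernelRepr_of_h0KernelRepr_dual` (`Motives.SeesawChartDualKernelRepr`,
B-p10 (g8)/(g9)). [cite: MumfordAV1970, §5 (pp. 46–47)] [cite: GortzWedhorn2023, Cor. 23.135 (p. 355) and (23.28.5)] -/
theorem dualKernelRepr_holds : SeesawRelative.DualKernelRepr X 𝓕 U h𝓕 :=
  SeesawRelative.dualKernelRepr_of_h0KernelRepr_dual X 𝓕 U h𝓕 (SeesawRelative.h0KernelRepr_holds X (Modules.dual 𝓕) U (hasRank_dual h𝓕))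

end Assembly

end SeesawRelative

end Literature.AlgebraicGeometry.Motives

end
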